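import Mathlib
import Literature.Analysis.FluidPDE.Tao2016AveragedNS.ShiftSetCascadeFlows
import Summits.NavierStokesRegularity.NavierStokesRegularity.Theorems.TaoLadderRungTwoFlatMirrorTableDefs
import Summits.NavierStokesRegularity.NavierStokesRegularity.Theorems.TaoLadderRungTwoFlatPulseDefs
import Summits.NavierStokesRegularity.NavierStokesRegularity.Theorems.TaoLadderRungTwoFlatCaptureDefs
import Summits.NavierStokesRegularity.NavierStokesRegularity.Theorems.TaoLadderRungTwoFlatSplitLayerDefs
import Summits.NavierStokesRegularity.NavierStokesRegularity.Theorems.TaoLadderRungTwoFlatGaugeGronwall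
import Summits.NavierStokesRegularity.NavierStokesRegularity.Theorems.TaoLadderRungTwoFlatNonlinearHop
import HarnessLib

/-!
# Tao ladder, rung 2♭ — GAUGE-SHARED CAPTURE interface for the two-layer split of K_A♭ (SPLIT-T48)

Tree-ready definitions module (proposed name `…Theorems.TaoLadderRungTwoFlatGaugeCaptureDefs`; cell copy
`harvest-h2-tao-ladder-theory-1/numT48/SplitLayerDefs48.lean`, theory-1 g36). It refines p675545
(`CapturedWithHeadroom`) after the g36 audit of SPLIT-T47: a transfer theorem quantified over ALL one-shell data
cannot be proved from window-only capture (a datum may shed a second, faster forward pulse; the behind junk must be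
quantitatively slow). The repaired interface:

* `HopContractionWith ε τ Φ ω ρ C N` — the body of `LinearisedHopContraction` with the gauge `ω` and the constants
  EXPOSED, so that the capture clause can be stated in the SAME gauge;
* `geomGauge g b` (`ω_{i,k} = g^{k⁺}·b^{−k⁻}`, species-uniform; certified `(4,2)`) and `headGauge g` (`= g^{k⁺}`) — the
  GEOMETRIC gauge the children fix `ω` to (p1 g20, bus l.675): `headGauge` is window-regular (`Λ = g`), window-admissible
  (`A = g`) and dominates `geomGauge` shifted (`Γ = 1`), the three structural hypotheses of `QuadPolar.nonlinear_hop_estimate`;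
* `junkThreshold ε = 3 / (8 (1+ε)²)` — the one explicit interface constant (`= 1/6` at `ε = ½`);
* `CapturedInGauge ε τ Φ ω X₀ i₀ β` — capture of the datum `X₀` by the scale-family member `κΦ(κ·)` with
  (H) headroom of the observable `i₀` at every checkpoint, (WG) convergence in the gauge `ω` on every half-line
  `k ≥ −K` of the co-moving frame (window AND everything ahead of it), (JB) the junk-energy bound
  `E(X₀) < κ²·E_{K₀}(Φ(0)) + β·(κ/τ)²` between conserved quantities (finite window sum, no `tsum`).

Why (JB) with this constant: for the mirror table the per-site energy obeys `ė_n = T_{n−1} − T_n` with the flux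
`T_n = λ^{5n/2}·v_n·a_{n+1}·(v_n + ε·a_{n+1})`; an exponentially weighted energy then bounds the speed of any
energy front by `(1+ε)·sup|X|·(sinh(θ/4)/(θ/4))` shells per unit time, while the captured front runs at `κ/τ`;
junk of energy `< β(κ/τ)²` has `sup|X| ≤ √(2β)·κ/τ`, and `2β(1+ε)² < 1` iff it can never catch the front —
`junkThreshold` leaves the prover the slack `(sinh(θ/4)/(θ/4))² < 4/3` (LADDER §48; x0E3: β₁ = 0.121 < 1/6).

Bridges: `HopContractionWith … → LinearisedHopContraction`, `CapturedInGauge … → CapturedWithHeadroom`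
(so the SPLIT-T48 children refine the SPLIT-T47 ones) and the gauge lemmas above. Predicates and elementary lemmas;
nothing about existence is asserted. MODEL lattice only; nothing about NS.
-/

-- the sub-problem namespace repeats the summit name by design (D-0017)
set_option linter.dupNamespace false

noncomputable section

namespace Summit.NavierStokesRegularity.NavierStokesRegularity.Theorems

open Set Filter Literature.Analysis.FluidPDE Literature.Analysis.FluidPDE.TaoCascade
open scoped Topology

namespace MirrorPulse

/-- **(S2-with) LINEARISED HOP CONTRACTION WITH EXPOSED GAUGE**: the body of `LinearisedHopContraction ε τ Φ`
for a GIVEN gauge `ω > 0`, contraction factor `0 ≤ ρ < 1`, projection bound `C ≥ 0` and hop count `N ≥ 1`.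
A predicate; nothing asserted. [cite: Tao2016AveragedNS, §6.3–6.4 (statement shape of a contraction certificate); route TaoLadderRungTwoFlat, posited object, λ₀ = 1 layer (S2)] -/
def HopContractionWith (ε τ : ℝ) (Φ : Fin 2 → ℤ → ℝ → ℝ) (ω : Fin 2 → ℤ → ℝ) (ρ C : ℝ) (N : ℕ) : Prop :=
  (∀ i k, 0 < ω i k) ∧ 0 ≤ ρ ∧ ρ < 1 ∧ 0 ≤ C ∧ 1 ≤ N ∧
    ∀ (u : Fin 2 → ℤ → ℝ → ℝ) (B : ℝ), IsVariationalOn ε (N * τ) Φ u →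
      (∀ i k, ω i k * |u i k 0| ≤ B) →
        ∃ c₁ c₂ : ℝ, |c₁| ≤ C * B ∧ |c₂| ≤ C * B ∧
          ∀ (i : Fin 2) (k : ℤ),
            ω i k * |u i (k + N) (N * τ)
              - c₁ * quadTermOn shiftSetFlat 0 (mirrorTable ε ε) Φ i (k + N) (N * τ)
              - c₂ * Φ i (k + N) (N * τ)| ≤ ρ * B

/-- Exposing the gauge loses nothing: `HopContractionWith ε τ Φ ω ρ C N → LinearisedHopContraction ε τ Φ`.
[cite: Tao2016AveragedNS, §6.3–6.4 (statement shape); route TaoLadderRungTwoFlat, λ₀ = 1 layer] -/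
theorem hopContractionWith_linearised {ε τ : ℝ} {Φ : Fin 2 → ℤ → ℝ → ℝ} {ω : Fin 2 → ℤ → ℝ} {ρ C : ℝ}
    {N : ℕ} (h : HopContractionWith ε τ Φ ω ρ C N) : LinearisedHopContraction ε τ Φ :=
  ⟨ω, ρ, C, N, h⟩

/-! ### The two-parameter GEOMETRIC gauge (the contraction gauge of the certificate; p1 g20's re-typing ask, bus l.675) -/

/-- The species-uniform **geometric gauge** `ω_{i,k} = g^{k⁺}·b^{−k⁻}`: growth `g` per shell AHEAD of the pulse
(`k ≥ 0`), decay `b` per shell BEHIND (`k < 0`); the certified λ₀ = 1 contraction uses `(g,b) = (4,2)` (CERT-LAMBDA1-SPEC §2).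
[cite: Tao2016AveragedNS, §6.3–6.4 (weighted stability of the transfer); route TaoLadderRungTwoFlat, posited object (λ₀ = 1 layer)] -/
def geomGauge (g b : ℝ) : Fin 2 → ℤ → ℝ := fun _ k => g ^ k.toNat * (b ^ (-k).toNat)⁻¹

/-- The **head gauge** `w_{i,k} = g^{k⁺}` (`= max(1, g^k)` for `g ≥ 1`): the window-regular, window-admissible majorant
through which `QuadPolar.nonlinear_hop_estimate` applies to the geometric gauge. [folklore; route TaoLadderRungTwoFlat, posited object] -/
def headGauge (g : ℝ) : Fin 2 → ℤ → ℝ := fun _ k => g ^ k.toNat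

/-- The geometric gauge is positive. [folklore] -/
theorem geomGauge_pos {g b : ℝ} (hg : 0 < g) (hb : 0 < b) (i : Fin 2) (k : ℤ) : 0 < geomGauge g b i k := by
  unfold geomGauge; positivity

/-- The head gauge is positive. [folklore] -/
theorem headGauge_pos {g : ℝ} (hg : 0 < g) (i : Fin 2) (k : ℤ) : 0 < headGauge g i k := by
  unfold headGauge; positivity

/-- The head gauge is at least one (for `g ≥ 1`). [folklore] -/
theorem one_le_headGauge {g : ℝ} (hg : 1 ≤ g) (i : Fin 2) (k : ℤ) : 1 ≤ headGauge g i k := by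
  unfold headGauge; exact one_le_pow₀ hg

/-- Behind the pulse the geometric gauge is `≤` the head gauge (`= 1` there), ahead they coincide. [folklore] -/
theorem geomGauge_le_headGauge {g b : ℝ} (hg : 0 ≤ g) (hb : 1 ≤ b) (i : Fin 2) (k : ℤ) :
    geomGauge g b i k ≤ headGauge g i k := by
  unfold geomGauge headGauge
  have h1 : 1 ≤ b ^ (-k).toNat := one_le_pow₀ hb
  have h2 : (b ^ (-k).toNat)⁻¹ ≤ 1 := inv_le_one_of_one_le₀ h1
  have h3 : 0 ≤ g ^ k.toNat := pow_nonneg hg _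
  calc g ^ k.toNat * (b ^ (-k).toNat)⁻¹ ≤ g ^ k.toNat * 1 := by gcongr
    _ = g ^ k.toNat := mul_one _

/-- One step of the head gauge: `w_k ≤ w_{k+1} ≤ g·w_k` for `g ≥ 1`. [folklore] -/
theorem headGauge_succ_le {g : ℝ} (hg : 1 ≤ g) (i : Fin 2) (k : ℤ) :
    headGauge g i k ≤ headGauge g i (k + 1) ∧ headGauge g i (k + 1) ≤ g * headGauge g i k := by
  unfold headGauge
  have hg0 : 0 ≤ g := le_trans zero_le_one hg
  rcases le_or_gt 0 k with hk | hk
  · have e1 : (k + 1).toNat = k.toNat + 1 := by omega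
    rw [e1, pow_succ]
    constructor
    · calc g ^ k.toNat = g ^ k.toNat * 1 := (mul_one _).symm
        _ ≤ g ^ k.toNat * g := by gcongr
    · exact le_of_eq (mul_comm _ _)
  · have e1 : k.toNat = 0 := by omega
    have e2 : (k + 1).toNat = 0 := by omega
    rw [e1, e2, pow_zero]
    exact ⟨le_rfl, by linarith⟩

/-- Monotone shift domination `w_k ≤ w_{k+N}` (`g ≥ 1`). [folklore] -/
theorem headGauge_le_shift {g : ℝ} (hg : 1 ≤ g) (i : Fin 2) (k : ℤ) (N : ℕ) :
    headGauge g i k ≤ headGauge g i (k + N) := by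
  induction N with
  | zero => simp
  | succ n ih =>
    calc headGauge g i k ≤ headGauge g i (k + n) := ih
      _ ≤ headGauge g i (k + n + 1) := (headGauge_succ_le hg i (k + n)).1
      _ = headGauge g i (k + (n + 1 : ℕ)) := by push_cast; ring_nf

/-- **The head gauge is window-regular with `Λ = g`** (`g ≥ 1`). [folklore] -/
theorem isWindowRegular_headGauge {g : ℝ} (hg : 1 ≤ g) : QuadPolar.IsWindowRegular (headGauge g) g := by
  have hg0 : 0 < g := lt_of_lt_of_le zero_lt_one hg
  refine ⟨headGauge_pos hg0, hg, ?_⟩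
  intro i j n k hk
  have hij : headGauge g j k = headGauge g i k := rfl
  rw [hij]
  have hwk : 0 ≤ headGauge g i k := (headGauge_pos hg0 i k).le
  rcases (show k = n - 1 ∨ k = n ∨ k = n + 1 by omega) with h | h | h
  · subst h
    have := (headGauge_succ_le hg i (n - 1)).2
    simp only [sub_add_cancel] at this
    exact this
  · subst h
    calc headGauge g i k = 1 * headGauge g i k := (one_mul _).symm
      _ ≤ g * headGauge g i k := by gcongr
  · subst h
    calc headGauge g i n ≤ headGauge g i (n + 1) := (headGauge_succ_le hg i n).1
      _ = 1 * headGauge g i (n + 1) := (one_mul _).symm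
      _ ≤ g * headGauge g i (n + 1) := by gcongr

/-- **The head gauge is window-admissible with `A = g`** (`g ≥ 1`): `w_n ≤ g·w_k·w_{k'}` on the window (`w ≥ 1`,
`w_n ≤ g·w_k`). [folklore] -/
theorem isWindowAdmissible_headGauge {g : ℝ} (hg : 1 ≤ g) : QuadPolar.IsWindowAdmissible (headGauge g) g := by
  have hg0 : 0 ≤ g := le_trans zero_le_one hg
  refine ⟨hg0, ?_⟩
  intro i j j' n k k' hk hk'
  have hreg := (isWindowRegular_headGauge hg).2.2 i j n k hk
  have h1 : 1 ≤ headGauge g j' k' := one_le_headGauge hg j' k'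
  have h0 : 0 ≤ g * headGauge g j k := mul_nonneg hg0 (headGauge_pos (lt_of_lt_of_le zero_lt_one hg) j k).le
  calc headGauge g i n ≤ g * headGauge g j k := hreg
    _ = g * headGauge g j k * 1 := (mul_one _).symm
    _ ≤ g * headGauge g j k * headGauge g j' k' := by gcongr

/-- **Domination of the geometric gauge by the shifted head gauge** (`Γ = 1`): `ω_{i,k} ≤ 1·w_{i,k+N}` (`g, b ≥ 1`) —
the hypothesis `hΓ` of `QuadPolar.nonlinear_hop_estimate`. [folklore] -/
theorem geomGauge_le_headGauge_shift {g b : ℝ} (hg : 1 ≤ g) (hb : 1 ≤ b) (i : Fin 2) (k : ℤ) (N : ℕ) :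
    geomGauge g b i k ≤ 1 * headGauge g i (k + N) := by
  rw [one_mul]
  exact (geomGauge_le_headGauge (le_trans zero_le_one hg) hb i k).trans (headGauge_le_shift hg i k N)

/-- **THE INTERFACE CONSTANT** of the split: the junk-energy threshold `β(ε) = 3 / (8 (1+ε)²)` (`= 1/6` at `ε = ½`).
Chosen so that `2·β·(1+ε)² = 3/4 < 1` (flux-lemma slack `4/3`) while the charged datum `x0E3` of `T♭(½)` has
`β₁ = 0.121 < 1/6` (float). [cite: Tao2016AveragedNS, §4 (4.3) (energy identity behind the flux bound); route TaoLadderRungTwoFlat, posited constant] -/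
def junkThreshold (ε : ℝ) : ℝ := 3 / (8 * (1 + ε) ^ 2)

/-- `junkThreshold (1/2) = 1/6`. [cite: Tao2016AveragedNS, §4; route TaoLadderRungTwoFlat] -/
theorem junkThreshold_half : junkThreshold (1 / 2) = 1 / 6 := by
  norm_num [junkThreshold]

/-- `0 < junkThreshold ε` for `0 ≤ ε`… indeed for every `ε ≠ −1`; we record the case `0 ≤ ε`.
[cite: Tao2016AveragedNS, §4; route TaoLadderRungTwoFlat] -/
theorem junkThreshold_pos {ε : ℝ} (hε : 0 ≤ ε) : 0 < junkThreshold ε := by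
  unfold junkThreshold; positivity

/-- **(S3♭) CAPTURE IN THE GAUGE `ω` WITH HEADROOM AND JUNK BOUND** of the one-shell datum `X₀` (observable
species `i₀`) by the pulse `Φ` of period `τ`: the datum solution `X`, a scale `κ > 0`, a headroom `η > 0`, a gap
bound `c`, checkpoint times `0 = s 0 < s 1 < …` with `s (n+1) ≤ s n + c`, and a window radius `K₀`, such that
(H) `(1+η)·|X₀ i₀| ≤ |X i₀ n (s n)|` for every `n ≥ 1`; (WG) for every `K` and `δ > 0`, eventually in `N`,
`ω i k · |X i (N+k) (s N) − κ·Φ i k 0| ≤ δ` for ALL `k ≥ −K` (the window and everything ahead of it, in the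
contraction gauge); (JB) `E(X₀) < κ²·E_{K₀}(Φ(0)) + β·(κ/τ)²` with `E = ½ Σ squares` (the energy NOT carried by
the captured front is less than `β` times the squared front speed `κ/τ`). A predicate; nothing asserted.
[cite: Tao2016AveragedNS, §6.2 Prop. 6.3 (checkpoint description, statement shape), §4 (4.3) (energy); route TaoLadderRungTwoFlat, posited object, λ₀ = 1 layer (S3♭)] -/
def CapturedInGauge (ε τ : ℝ) (Φ : Fin 2 → ℤ → ℝ → ℝ) (ω : Fin 2 → ℤ → ℝ) (X₀ : Fin 2 → ℝ) (i₀ : Fin 2)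
    (β : ℝ) : Prop :=
  ∃ (X : Fin 2 → ℤ → ℝ → ℝ) (κ η c : ℝ) (s : ℕ → ℝ) (K₀ : ℕ), IsDatumSol ε X₀ X ∧ 0 < κ ∧ 0 < η ∧
    StrictMono s ∧ s 0 = 0 ∧ (∀ n : ℕ, s (n + 1) ≤ s n + c) ∧
    (∀ n : ℕ, 1 ≤ n → (1 + η) * |X₀ i₀| ≤ |X i₀ (n : ℤ) (s n)|) ∧
    (∀ (K : ℕ) (δ : ℝ), 0 < δ → ∃ N₀ : ℕ, ∀ N : ℕ, N₀ ≤ N →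
      ∀ (i : Fin 2) (k : ℤ), -(K : ℤ) ≤ k → ω i k * |X i ((N : ℤ) + k) (s N) - κ * Φ i k 0| ≤ δ) ∧
    (∑ i : Fin 2, X₀ i ^ 2) / 2
      < κ ^ 2 * ((∑ i : Fin 2, ∑ k ∈ Finset.Icc (-(K₀ : ℤ)) K₀, Φ i k 0 ^ 2) / 2) + β * (κ / τ) ^ 2

/-- (S3♭) implies (S3♯): gauge capture gives window capture with headroom (`ω > 0` has a positive minimum on
every finite window). [cite: Tao2016AveragedNS, §6.2 (statement shape); route TaoLadderRungTwoFlat, λ₀ = 1 layer] -/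
theorem capturedInGauge_withHeadroom {ε τ : ℝ} {Φ : Fin 2 → ℤ → ℝ → ℝ} {ω : Fin 2 → ℤ → ℝ}
    {X₀ : Fin 2 → ℝ} {i₀ : Fin 2} {β : ℝ} (hω : ∀ i k, 0 < ω i k)
    (h : CapturedInGauge ε τ Φ ω X₀ i₀ β) : CapturedWithHeadroom ε Φ X₀ i₀ := by
  obtain ⟨X, κ, η, c, s, K₀, hX, hκ, hη, hs, hs0, hgap, hhead, hWG, -⟩ := h
  refine ⟨X, κ, η, c, s, hX, hκ, hη, hs, hs0, hgap, hhead, ?_⟩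
  intro K δ hδ
  -- positive minimum of the gauge on the finite window `Fin 2 × [-K, K]`
  let S : Finset (Fin 2 × ℤ) := Finset.univ ×ˢ Finset.Icc (-(K : ℤ)) K
  have hSne : S.Nonempty := ⟨(0, 0), by simp [S]⟩
  let m : ℝ := S.inf' hSne (fun p => ω p.1 p.2)
  have hm : 0 < m := by
    simp only [m, Finset.lt_inf'_iff]
    intro p _; exact hω p.1 p.2
  have hmle : ∀ (i : Fin 2) (k : ℤ), |k| ≤ K → m ≤ ω i k := by
    intro i k hk
    have hmem : (i, k) ∈ S := by
      simp only [S, Finset.mem_product, Finset.mem_univ, Finset.mem_Icc, true_and]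
      exact abs_le.mp hk
    exact Finset.inf'_le (fun p => ω p.1 p.2) hmem
  obtain ⟨N₀, hN₀⟩ := hWG K (δ * m) (mul_pos hδ hm)
  refine ⟨N₀, fun N hN i k hk => ?_⟩
  have h1 := hN₀ N hN i k (abs_le.mp hk).1
  have h2 : m ≤ ω i k := hmle i k hk
  have hωpos := hω i k
  -- ω·|d| ≤ δ·m ≤ δ·ω  ⇒  |d| ≤ δ
  have h3 : ω i k * |X i ((N : ℤ) + k) (s N) - κ * Φ i k 0| ≤ ω i k * δ := by
    calc ω i k * |X i ((N : ℤ) + k) (s N) - κ * Φ i k 0| ≤ δ * m := h1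
      _ ≤ δ * ω i k := by exact mul_le_mul_of_nonneg_left h2 hδ.le
      _ = ω i k * δ := by ring
  exact le_of_mul_le_mul_left h3 hωpos

/-- (S3♭)'s anchor consequence (as for S3♯): the observable beats its anchor strictly at shell `1`.
[cite: Tao2016AveragedNS, §6.2 (statement shape); route TaoLadderRungTwoFlat, λ₀ = 1 layer] -/
theorem CapturedInGauge.anchor_lt {ε τ : ℝ} {Φ : Fin 2 → ℤ → ℝ → ℝ} {ω : Fin 2 → ℤ → ℝ} {X₀ : Fin 2 → ℝ}
    {i₀ : Fin 2} {β : ℝ} (hω : ∀ i k, 0 < ω i k) (h : CapturedInGauge ε τ Φ ω X₀ i₀ β) (hX₀ : X₀ i₀ ≠ 0) :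
    ∃ (X : Fin 2 → ℤ → ℝ → ℝ) (t : ℝ), IsDatumSol ε X₀ X ∧ 0 < t ∧ |X₀ i₀| < |X i₀ 1 t| :=
  (capturedInGauge_withHeadroom hω h).anchor_lt hX₀

end MirrorPulse

end Summit.NavierStokesRegularity.NavierStokesRegularity.Theorems

end
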